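import Summits.CriticalPhenomena.CardyFormulaZ2.Theorems.CardyBoundaryCoulombGasStripClusterRatesConfinedGlueTransfer
import HarnessLib

/-!
# End separation and the two-cluster half of `StripClusterRates` imply the CONFINED Cardy-order lower bound

Support file for line `two-cluster-rate-is-stationary-gap` (crux `StripClusterRates`,
stmt-CriticalPhenomena-13878), lead c8, stub `c8_confinedLower_of_sep_kacTwo` (T6b, "SEP + K₂ ⇒ confined
Cardy-order lower bound"); the confined twin of lead c7's `co_cardyOrderTwoLower_of_kacTwo`, modulo END
SEPARATION.

Let `f(M,b)` be the probability (bond percolation on `ℤ²` at `p = 1/2`) of the END-CONFINED block event on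
`[0,M]×[0,3b+2]` of lead c6's `…ConfinedGlueTransfer` (two end-confined open long crossings with their fences and
an end-confined dual-open long face crossing in between), and let `γ₂ : ℕ → ℝ` be a family of two-cluster rates
in TRANSFER-MATRIX order (`−log p₂(m,n)/m → γ₂(n)` for every width `n ≥ 1`) with the Kac limit `n·γ₂(n) → 2π`
(the γ₂-half of the crux). Assume moreover

* END SEPARATION `SEP(f)`: `c · p₂(M, 3b+2) ≤ f(M + k(3b+2), b)` for all `b ≥ b₀`, `M ≥ 1`, with absolute
  `c > 0`, `k ≥ 1` (a plain two-cluster crossing upgrades to an end-confined one `k` widths longer at bounded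
  cost — an RSW-level hypothesis, NOT proved here);
* the a-priori lower bound `APL(f)`: `exp(−C·A) ≤ f(A(3b+2), b)` for `A ≥ 1`, `b ≥ 2`.

Then the confined event obeys a Cardy-order LOWER bound with exponent `2π`:

  `∃ G, G(A)/A → 2π ∧ ∀ A ≥ 1, ∀ᶠ b, exp(−G(A)) ≤ f(A(3b+2), b)`.

Proof. Write `n = 3b+2`. For `A > k`, `SEP` at `M = (A−k)·n` (note `(A−k)n + kn = An`) and the finite-length
bound `−log p₂(m,n)/(m+1) ≤ γ₂(n)` (`rateTwo_ge_finite`, from sub-multiplicativity of `p₂` in the length) give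
`f(A·n, b) ≥ c·p₂((A−k)n, n) ≥ c·exp(−γ₂(n)((A−k)n + 1))`, and
`γ₂(n)((A−k)n + 1) = (A−k)·(n·γ₂(n)) + γ₂(n) ≤ (A−k)(2π + 1/A) + 3 log 2` eventually in `b`
(`n·γ₂(n) ≤ 2π + 1/A` eventually by the Kac limit along `n = 3b+2 → ∞`, and `γ₂ ≤ 3 log 2` by `rateTwo_le`).
For `1 ≤ A ≤ k` use `APL` directly. Hence

  `G(A) := C·A` for `A ≤ k`,  `G(A) := (A−k)(2π + 1/A) + 3 log 2 − log c` for `A > k`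

works, and `G(A)/A = (1 − k/A)(2π + 1/A) + O(1/A) → 2π`.

No definitions; `pTwo`, `rateSeqTwo` are the abbreviations of `Negative.KacFromAboveFalse`, and the registered
form `c8_confinedLower_of_sep_kacTwo` abstracts the confined probability as `f` exactly as `cg_rateTwo_le_confined`
does (its defining equation is not even used: only `SEP`, `APL` and the rates enter).

References: [Cardy1998] eq. (bb); [Nolin2008] §4 (separation of arms); M. Fekete (1923).
-/

noncomputable section

open MeasureTheory Filter Topology Set
open Literature.Probability.LatticeModels Literature.Probability.Percolation
open Summit.CriticalPhenomena.CardyFormulaZ2.Theorems.StripClusterRates.Negative (pOne pTwo rateSeqTwo rateSeqOne rateTwo_le)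

namespace Summit.CriticalPhenomena.CardyFormulaZ2.Cruxes.StripClusterRates.TwoClusterRateIsStationaryGap

/-! ## §1 Two elementary limits -/

/-- `((A − k)(2π + 1/A) + κ)/A → 2π` as `A → ∞` (`(1 − k/A)(2π + 1/A) → 2π`, `κ/A → 0`). [folklore] -/
theorem cls_tendsto_G_div (k : ℕ) (κ : ℝ) :
    Tendsto (fun A : ℕ ↦ (((A : ℝ) - k) * (2 * Real.pi + 1 / (A : ℝ)) + κ) / A) atTop (𝓝 (2 * Real.pi)) := by
  refine cg_tendsto_add_const_div ?_ κ
  have h1 : Tendsto (fun A : ℕ ↦ 1 / (A : ℝ)) atTop (𝓝 0) := tendsto_one_div_atTop_nhds_zero_nat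
  have hk : Tendsto (fun A : ℕ ↦ (k : ℝ) / (A : ℝ)) atTop (𝓝 0) :=
    tendsto_const_nhds.div_atTop tendsto_natCast_atTop_atTop
  have h : Tendsto (fun A : ℕ ↦ (1 - (k : ℝ) / (A : ℝ)) * (2 * Real.pi + 1 / (A : ℝ))) atTop
      (𝓝 ((1 - 0) * (2 * Real.pi + 0))) :=
    (tendsto_const_nhds.sub hk).mul (tendsto_const_nhds.add h1)
  rw [sub_zero, add_zero, one_mul] at h
  refine h.congr' ?_
  filter_upwards [eventually_ge_atTop 1] with A hA
  have hA0 : (A : ℝ) ≠ 0 := by exact_mod_cast Nat.one_le_iff_ne_zero.mp hA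
  field_simp

/-- Along the widths `n = 3b+2` the Kac limit gives `(3b+2)·γ₂(3b+2) ≤ 2π + 1/A` eventually in `b`
(`A ≥ 1`); the mirror image of `cuk_eventually_kac_ge`. [folklore] -/
theorem cls_eventually_kac_le {γ₂ : ℕ → ℝ}
    (hK : Tendsto (fun n : ℕ ↦ (n : ℝ) * γ₂ n) atTop (𝓝 (2 * Real.pi))) {A : ℕ} (hA : 1 ≤ A) :
    ∀ᶠ b : ℕ in atTop, ((3 * b + 2 : ℕ) : ℝ) * γ₂ (3 * b + 2) ≤ 2 * Real.pi + 1 / (A : ℝ) := by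
  have hA' : (0 : ℝ) < A := by exact_mod_cast hA
  have hlt : 2 * Real.pi < 2 * Real.pi + 1 / (A : ℝ) := by
    have : (0 : ℝ) < 1 / (A : ℝ) := by positivity
    linarith
  have h3 : Tendsto (fun b : ℕ ↦ 3 * b + 2) atTop atTop :=
    tendsto_atTop_mono (fun b : ℕ ↦ (by omega : b ≤ 3 * b + 2)) tendsto_id
  exact (hK.comp h3).eventually_le_const hlt

/-! ## §2 The long blocks: end separation and the finite-length rate bound -/

/-- The finite-length rate bound in exponential form: `exp(−γ·(m+1)) ≤ p₂(m,n)` for every `m`, every width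
`n ≥ 1` and every limit `γ` of `−log p₂(·,n)/·` (`rateTwo_ge_finite`, `p₂ > 0`). [folklore] -/
theorem cls_exp_le_pTwo {n : ℕ} (hn : 1 ≤ n) {γ : ℝ} (h : Tendsto (rateSeqTwo n) atTop (𝓝 γ)) (m : ℕ) :
    Real.exp (-(γ * ((m : ℝ) + 1))) ≤ pTwo m n := by
  have hfin := rateTwo_ge_finite hn h m
  have hp := co_pTwo_pos hn m
  rw [div_le_iff₀ (by positivity)] at hfin
  calc Real.exp (-(γ * ((m : ℝ) + 1))) ≤ Real.exp (Real.log (pTwo m n)) := Real.exp_le_exp.2 (by linarith)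
    _ = pTwo m n := Real.exp_log hp

/-- **Long blocks.** Under end separation with constants `c > 0`, `b₀`, `k`
(`c·p₂(M, 3b+2) ≤ f(M + k(3b+2), b)` for `b ≥ b₀`, `M ≥ 1`) and two-cluster rates `γ₂` with the Kac limit
`n·γ₂(n) → 2π`: for every `A > k`, eventually in `b`,
`exp(−((A−k)(2π + 1/A) + 3 log 2 − log c)) ≤ f(A(3b+2), b)`. [folklore] -/
theorem cls_long_blocks (f : ℕ → ℕ → ℝ) {c : ℝ} (hc : 0 < c) {b₀ k : ℕ}
    (hsep : ∀ b : ℕ, b₀ ≤ b → ∀ M : ℕ, 1 ≤ M → c * pTwo M (3 * b + 2) ≤ f (M + k * (3 * b + 2)) b)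
    {γ₂ : ℕ → ℝ} (h₂ : ∀ n : ℕ, 1 ≤ n → Tendsto (rateSeqTwo n) atTop (𝓝 (γ₂ n)))
    (hK : Tendsto (fun n : ℕ ↦ (n : ℝ) * γ₂ n) atTop (𝓝 (2 * Real.pi))) {A : ℕ} (hkA : k < A) :
    ∀ᶠ b : ℕ in atTop, Real.exp (-(((A : ℝ) - k) * (2 * Real.pi + 1 / (A : ℝ)) +
      (3 * Real.log 2 - Real.log c))) ≤ f (A * (3 * b + 2)) b := by
  have hA : 1 ≤ A := by omega
  have hAk' : (0 : ℝ) ≤ (A : ℝ) - k := by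
    have : (k : ℝ) ≤ A := by exact_mod_cast hkA.le
    linarith
  filter_upwards [cls_eventually_kac_le hK hA, eventually_ge_atTop b₀] with b hb hbb₀
  set n : ℕ := 3 * b + 2 with hn
  have hn1 : 1 ≤ n := by omega
  have hM : 1 ≤ (A - k) * n := by
    have h1 : 1 ≤ A - k := by omega
    calc 1 = 1 * 1 := rfl
      _ ≤ (A - k) * n := Nat.mul_le_mul h1 hn1
  have hsepb := hsep b hbb₀ ((A - k) * n) hM
  have heq : (A - k) * n + k * n = A * n := by rw [← Nat.add_mul, Nat.sub_add_cancel hkA.le]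
  rw [heq] at hsepb
  have hexp := cls_exp_le_pTwo hn1 (h₂ n hn1) ((A - k) * n)
  have hγle : γ₂ n ≤ 3 * Real.log 2 := rateTwo_le hn1 (h₂ n hn1)
  have hcast : (((A - k) * n : ℕ) : ℝ) = ((A : ℝ) - k) * n := by
    rw [Nat.cast_mul, Nat.cast_sub hkA.le]
  have hbound : γ₂ n * ((((A - k) * n : ℕ) : ℝ) + 1) ≤
      ((A : ℝ) - k) * (2 * Real.pi + 1 / (A : ℝ)) + 3 * Real.log 2 := by
    rw [hcast]
    calc γ₂ n * (((A : ℝ) - k) * n + 1) = ((A : ℝ) - k) * ((n : ℝ) * γ₂ n) + γ₂ n := by ring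
      _ ≤ ((A : ℝ) - k) * (2 * Real.pi + 1 / (A : ℝ)) + 3 * Real.log 2 :=
          add_le_add (mul_le_mul_of_nonneg_left hb hAk') hγle
  have hrew : -(((A : ℝ) - k) * (2 * Real.pi + 1 / (A : ℝ)) + (3 * Real.log 2 - Real.log c)) =
      Real.log c + -(((A : ℝ) - k) * (2 * Real.pi + 1 / (A : ℝ)) + 3 * Real.log 2) := by ring
  calc Real.exp (-(((A : ℝ) - k) * (2 * Real.pi + 1 / (A : ℝ)) + (3 * Real.log 2 - Real.log c)))
      = c * Real.exp (-(((A : ℝ) - k) * (2 * Real.pi + 1 / (A : ℝ)) + 3 * Real.log 2)) := by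
        rw [hrew, Real.exp_add, Real.exp_log hc]
    _ ≤ c * Real.exp (-(γ₂ n * ((((A - k) * n : ℕ) : ℝ) + 1))) :=
        mul_le_mul_of_nonneg_left (Real.exp_le_exp.2 (neg_le_neg hbound)) hc.le
    _ ≤ c * pTwo ((A - k) * n) n := mul_le_mul_of_nonneg_left hexp hc.le
    _ ≤ f (A * n) b := hsepb

/-! ## §3 The confined Cardy-order lower bound -/

/-- **End separation and the γ₂-half of the crux imply the confined Cardy-order lower bound** (`f`
abstracted as in `cg_rateTwo_le_confined`): under `SEP(f)` (constants `c, b₀, k`), the a-priori bound `APL(f)`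
(constant `C`), two-cluster rates `−log p₂(m,n)/m → γ₂(n)` (`n ≥ 1`) and the Kac limit `n·γ₂(n) → 2π`, the
function `G(A) := C·A` for `A ≤ k`, `G(A) := (A−k)(2π + 1/A) + 3 log 2 − log c` for `A > k` satisfies
`G(A)/A → 2π` and, for every `A ≥ 1`, `exp(−G(A)) ≤ f(A(3b+2), b)` eventually in `b`.
[cite: Cardy1998, eq. (bb)] -/
theorem cls_confinedLower (f : ℕ → ℕ → ℝ)
    (hsep : ∃ c : ℝ, 0 < c ∧ ∃ b₀ k : ℕ, 1 ≤ k ∧ ∀ b : ℕ, b₀ ≤ b → ∀ M : ℕ, 1 ≤ M →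
      c * pTwo M (3 * b + 2) ≤ f (M + k * (3 * b + 2)) b)
    (hapl : ∃ C : ℝ, 0 < C ∧ ∀ A b : ℕ, 1 ≤ A → 2 ≤ b → Real.exp (-(C * A)) ≤ f (A * (3 * b + 2)) b)
    {γ₂ : ℕ → ℝ} (h₂ : ∀ n : ℕ, 1 ≤ n → Tendsto (rateSeqTwo n) atTop (𝓝 (γ₂ n)))
    (hK : Tendsto (fun n : ℕ ↦ (n : ℝ) * γ₂ n) atTop (𝓝 (2 * Real.pi))) :
    ∃ G : ℕ → ℝ, Tendsto (fun A : ℕ ↦ G A / A) atTop (𝓝 (2 * Real.pi)) ∧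
      ∀ A : ℕ, 1 ≤ A → ∀ᶠ b : ℕ in atTop, Real.exp (-G A) ≤ f (A * (3 * b + 2)) b := by
  obtain ⟨c, hc, b₀, k, _, hsep⟩ := hsep
  obtain ⟨C, _, hapl⟩ := hapl
  refine ⟨fun A ↦ if A ≤ k then C * A else
      ((A : ℝ) - k) * (2 * Real.pi + 1 / (A : ℝ)) + (3 * Real.log 2 - Real.log c), ?_, fun A hA ↦ ?_⟩
  · refine (cls_tendsto_G_div k (3 * Real.log 2 - Real.log c)).congr' ?_
    filter_upwards [eventually_gt_atTop k] with A hA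
    rw [if_neg (not_le.2 hA)]
  · by_cases hAk : A ≤ k
    · simp only [if_pos hAk]
      filter_upwards [eventually_ge_atTop 2] with b hb
      exact hapl A b hA hb
    · simp only [if_neg hAk]
      exact cls_long_blocks f hc hsep h₂ hK (not_le.1 hAk)

/-- **Registered form** (stub `c8_confinedLower_of_sep_kacTwo` of stmt-CriticalPhenomena-13878, lead c8; T6b):
with `f(M,b)` the probability of the end-confined block event on `[0,M]×[0,3b+2]`, END SEPARATION `SEP(f)` and the
a-priori bound `APL(f)`, every family `γ₂` of two-cluster rates with the Kac limit `n·γ₂(n) → 2π` yields `G` with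
`G(A)/A → 2π` and `exp(−G(A)) ≤ f(A(3b+2), b)` eventually in `b`, for every `A ≥ 1` (= `cls_confinedLower`; the
necessary direction of the confined half CL of CO₂, modulo end separation). [cite: Cardy1998, eq. (bb)] -/
theorem c8_confinedLower_of_sep_kacTwo : ∀ f : ℕ → ℕ → ℝ, f = (fun M b : ℕ => (bondPercolation (zdGraph 2) half).real ((openCrossing {z ∈ (rectangle M (3 * b + 2) : Set (Site 2)) | (z 0 ≤ (b : ℤ) ∨ (M : ℤ) ≤ z 0 + b) → z 1 ≤ (b : ℤ)} (leftSide M (3 * b + 2) : Set (Site 2)) (rightSide M (3 * b + 2) : Set (Site 2)) ∩ tbCrossing b b ∩ openCrossing {z ∈ (rectangle M (3 * b + 2) : Set (Site 2)) | (z 0 ≤ (b : ℤ) ∨ (M : ℤ) ≤ z 0 + b) → 2 * (b : ℤ) + 2 ≤ z 1} (leftSide M (3 * b + 2) : Set (Site 2)) (rightSide M (3 * b + 2) : Set (Site 2)) ∩ (BondConfig.relabel (sym2Equiv (Site.shift (-pt 0 (2 * (b : ℤ) + 2))))) ⁻¹' tbCrossing b b) ∩ (dualConfig ⁻¹' openCrossing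 {z ∈ ((· + pt (-1) 0) '' (rectangle (M + 1) (3 * b + 1) : Set (Site 2))) | (z 0 ≤ (b : ℤ) ∨ (M : ℤ) ≤ z 0 + b) → (b : ℤ) + 1 ≤ z 1 ∧ z 1 ≤ 2 * (b : ℤ)} ((· + pt (-1) 0) '' (leftSide (M + 1) (3 * b + 1) : Set (Site 2))) ((· + pt (-1) 0) '' (rightSide (M + 1) (3 * b + 1) : Set (Site 2)))))) → (∃ c : ℝ, 0 < c ∧ ∃ b₀ k : ℕ, 1 ≤ k ∧ ∀ b : ℕ, b₀ ≤ b → ∀ M : ℕ, 1 ≤ M → c * pTwo M (3 * b + 2) ≤ f (M + k * (3 * b + 2)) b) → (∃ C : ℝ, 0 < C ∧ ∀ A b : ℕ, 1 ≤ A → 2 ≤ b → Real.exp (-(C * A)) ≤ f (A * (3 * b + 2)) b) → ∀ γ₂ : ℕ → ℝ, (∀ n : ℕ, 1 ≤ n → Tendsto (rateSeqTwo n) atTop (𝓝 (γ₂ n))) → Tendsto (fun n : ℕ ↦ (n : ℝ) * γ₂ n) atTop (𝓝 (2 * Real.pi)) → (∃ G : ℕ → ℝ, Tendsto (fun A : ℕ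 ↦ G A / A) atTop (𝓝 (2 * Real.pi)) ∧ ∀ A : ℕ, 1 ≤ A → ∀ᶠ b : ℕ in atTop, Real.exp (-G A) ≤ f (A * (3 * b + 2)) b) :=
  fun f _ hsep hapl _ h₂ hK => cls_confinedLower f hsep hapl h₂ hK

end Summit.CriticalPhenomena.CardyFormulaZ2.Cruxes.StripClusterRates.TwoClusterRateIsStationaryGap

end
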